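import Literature.MathematicalPhysics.QuantumFieldTheory.Balaban1983to89.Node00.N24NodesStage13XReboundPointedSep
import Literature.MathematicalPhysics.QuantumFieldTheory.Balaban1983to89.B16RLeafRecord13AtLive

/-!
# ⁗ EDITION (v1.2 RE-KEY of module 44 `N24NodesStage13XReboundPointedAtFamilies`, REV 18: token map as in 43⁗; K1⁗ stmt-QuantumFields-20290; at the family members
# `theta13LiveOfNumerics n ε₂₉ ζ Rz Zt` ∕ `theta13LiveOfFamily₂ ε₀ ε₂₉ ζ Rz Zt` (generic residual letters) N13's (R₁₃) ← dag-n11-e's v1.2 `B16RLeafRecord13Sep.laws₁₃_liveRepin₁₃_sep` at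
# `theta13OfNumerics ∕ theta13OfFamily₂` with K0a's `admissible_theta13OfNumerics hn hε'` ∕ `admissible_theta13OfFamily₂ hε hε'` and n11-e's sign lemmas; `SlotsNondegenerate₁₃` ←
# K0a's `slotsNondegenerate₁₃_liveRepin_of_int` from `hP.tstep ∕ hP.rstep`)
# NODE N24 · ITEM K1⁗'s θ-KEYED CONSEQUENT AND RUNG BODY AT node00-def-K0a's STAGE-13 WITNESS FAMILIES — `θ₁₃(n, ε₂₉) = theta13LiveOfNumerics F N n ε₂₉ ζ Rz Zt`
# (every numeric letter an argument; the member the plan's K0⁗ skeleton and dag-n10-d ∕ dag-n08-c's ₁₃ family storeys choose) and `θ₁₃(ε₀, ε₂₉) = theta13LiveOfFamily₂ F N ε₀ ε₂₉ ζ Rz Zt`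
# (the open-letter member the (D4) ∕ N26 road can meet — dag-ref-D READ-167's attention-route), CHILDREN OVER THE X-REBOUND FOUR-PIN VIEW (module 43): `Admissible`,
# `SlotsNondegenerate₁₃`, N13's (R₁₃) THEOREMS there (K0a FILE 9 `admissible_theta13OfNumerics ∕ OfFamily₂`, `slotsNondegenerate₁₃_liveRepin_of_int`; dag-n11-e v1.2 `B16RLeafRecord13Sep.laws₁₃_liveRepin₁₃_sep`); `ZtUnity` displayed as `hZ` (a theorem at K0b's residuals of
# record: `ztUnity_theta13LiveOfNumerics`, `ztUnity_theta13LiveOfFamily₂`); `n.Pos`, `0 < ε₂₉` (resp. `0 < ε₀`, `0 < ε₂₉`) and `n`'s three term-constant signs displayed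

TRACK A (YM-PLAN §2d, node N24 of 28 = binder B2), seat `pub-ymgap-dag-n24-c` (R134 fan-out seat, strategy s2; gen 4; HANDOFF trigger (t8) REV 18).  FORTY-FOURTH N24 module, a NEW importing one (imports module 43⁗
`N24NodesStage13XReboundPointedSep` and dag-n11-e's `B16RLeafRecord13AtLive` for the sign lemmas).  THEOREMS ONLY, def-free, sorry-free, standard axioms.  Route rev 19: item K1⁗ `StabilityBAtRecordR13Sep` (stmt-QuantumFields-20290).

WHAT THIS FILE PROVES (general `N`; N24 COMPOSITE — hypothesis lists are «which child blocks AT THE FAMILY MEMBER», nothing is discharged as a node).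
§1 at `theta13LiveOfNumerics F N n ε₂₉ ζ Rz Zt`: **`N24_stabilityBR13Sep_thetaShape18_rebindX_fourPin_pointed_theta13LiveOfNumerics`** (K1⁗'s θ-keyed consequent witnessed by the member and
   `hP`) and **`N24_betaWindowAtSomeRecord₁₃Sep_of_rebindX_fourPin_pointed_theta13LiveOfNumerics_of_boxH`** (∃-body of the registered rung `BetaWindowAtSomeRecord13`).
§2 at `theta13LiveOfFamily₂ F N ε₀ ε₂₉ ζ Rz Zt`: **`N24_stabilityBR13Sep_thetaShape18_rebindX_fourPin_pointed_theta13LiveOfFamily₂`**,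
   **`N24_betaWindowAtSomeRecord₁₃Sep_of_rebindX_fourPin_pointed_theta13LiveOfFamily₂_of_boxH`**.
In all four: N05 ∕ N09 ∕ N10 sockets at the chosen carrier family `X' P` (the members' own `res.X` is the degenerate one — dag-n10-d LOCATED-N24-XSOCKET), N06 ∕ N07 ∕ N12 at chosen
layers `(M⋆, ops)`, `ζ9`, `λW`, N08 ← THE PRINTED `PrintedUV3V N θ.L`, N11 (S1ᵀ) displayed, N13 (UV₁₃) displayed, the β-box pair displayed ([I] (1.22) p. 264; lower half UNPRINTED,
node O), `hP : Provisos₁₃Sep` at the member displayed (K0⁗ stmt-QuantumFields-20289's residual via K0a FILE 12a's `provisos₁₃Sep_theta13LiveOfNumerics_of_bgSep`).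
HONEST FRAMING: kernel bookkeeping BY NAME; nothing of Bałaban's asserted; no discharge, no count moved (5∕27), no stub closed; one finite T⁴ programme at fixed ε; NOT continuum ∕ ℝ⁴ ∕ OS ∕
mass gap ∕ Clay.
-/

noncomputable section

open scoped Matrix.Norms.L2Operator

namespace Literature.MathematicalPhysics.QuantumFieldTheory.Balaban1983to89.Node00

open DagBinding T4Continuum T4DatumAssembly FlowStepRuns AveragingRT
open FlowStep (BetaLowerH BetaUpperH)
open B16RLeafRecord13Sep (laws₁₃_liveRepin₁₃_sep)
open B16RLeafRecord13AtLive (kappa_nonneg_theta13LiveOfFamily₂ E0_nonneg_theta13LiveOfFamily₂ B0_nonneg_theta13LiveOfFamily₂)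

variable {F : T4Family} {N : ℕ} [NeZero N]

/-! ## §1. At the all-numerics member `theta13LiveOfNumerics F N n ε₂₉ ζ Rz Zt` -/

/-- **★ ITEM K1⁗'s θ-KEYED CONSEQUENT WITNESSED BY `(theta13LiveOfNumerics F N n ε₂₉ ζ Rz Zt, hP)`, CHILDREN OVER THE X-REBOUND FOUR-PIN VIEW** — `Admissible`
(`admissible_theta13LiveOfNumerics hn hε'`), `SlotsNondegenerate₁₃` (K0a's `slotsNondegenerate₁₃_liveRepin_of_int` from `hP.tstep ∕ hP.rstep`), N13's (R₁₃) (dag-n11-e's `laws₁₃_liveRepin₁₃_sep` at `theta13OfNumerics`, `admissible_theta13OfNumerics hn hε'`, signs of `n` displayed) by name; `hZ` displayed.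
[cite: Balaban1989LargeFieldII, Thm 1 p.355, (0.1) pp.355–356, p.391; Balaban1988Convergent, p.244, Thm 2 p.263, (2.4) p.255, (2.28) p.259, (3.16)–(3.22) pp.268–269; Balaban1989LargeFieldI, (0.2)–(0.4) p.176; Balaban1987RG1, (0.21) p.256, (2.9) p.266, Thm 3 p.264, (1.22) p.264; Balaban1985UV3, Thm 1 p.257 (bookkeeping + elementary window)] -/
theorem N24_stabilityBR13Sep_thetaShape18_rebindX_fourPin_pointed_theta13LiveOfNumerics {n : Stage12Numerics} {ε₂₉ : ℝ} (hn : n.Pos) (hε' : 0 < ε₂₉)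
    (hκ : 0 ≤ n.s2.lf.κ) (hE₀ : 0 ≤ n.s2.lf.E₀) (hB₀ : 0 ≤ n.s2.lf.B₀) (ζ : ZetaOfRecord F N n.ν n.τ9.M) (Rz : (K : ℕ) → Sect2.Residual (F.P K) (MatA N))
    (Zt : (K : ℕ) → TkResidualW F N (FluctV N) K) (hP : (theta13LiveOfNumerics F N n ε₂₉ ζ Rz Zt).Provisos₁₃Sep F N)
    (hZ : (theta13LiveOfNumerics F N n ε₂₉ ζ Rz Zt).ZtUnity F N) (X' : B12.RunParams → PrintedCarriersR)
    (Mstar : ℕ) (ops : OpsY N (theta13LiveOfNumerics F N n ε₂₉ ζ Rz Zt).toStage3Params Mstar) (ζ9 : ResidZ F N) (lamW : ResidW F N) (w : WorldP)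
    (hC : w.C = (datumOfRecord₁₃Sep F N (theta13LiveOfNumerics F N n ε₂₉ ζ Rz Zt) hP).C) (hγ : 0 < w.γ ∧ w.γ ≤ (theta13LiveOfNumerics F N n ε₂₉ ζ Rz Zt).γ) (hL : w.L = ((theta13LiveOfNumerics F N n ε₂₉ ζ Rz Zt).L : ℝ))
    (hup : ∀ P, w.up P = upOfRecord₅C F N (((theta13LiveOfNumerics F N n ε₂₉ ζ Rz Zt).rebindX F N X').view₁₃B10YZW F N Mstar ops ζ9 lamW) P)
    (h05 : ∀ P : B12.RunParams,
      B8LeafR (X' P).d8 (X' P).L8 (X' P).C₂ (X' P).B₁' (X' P).B₀' (X' P).B₁ (X' P).B₂ (X' P).c₁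
        (X' P).inp8 (X' P).B₀β (X' P).loc8 (X' P).fam8R (X' P).lan8 (X' P).cub8 (X' P).toAxial8)
    (h06 : B9LeafX (Y9OfRecord N (theta13LiveOfNumerics F N n ε₂₉ ζ Rz Zt).toStage3Params Mstar ops))
    (h07 : B11Leaf (Z11OfRecord F N ζ9))
    (h08 : PrintedUV3V N (theta13LiveOfNumerics F N n ε₂₉ ζ Rz Zt).L)
    (h09 : ∀ P : B12.RunParams, B12Sec2to5.Lemma4Printed (X' P).F12 (X' P).c12)
    (h09T : ∀ P : B12.RunParams, (leavesP w P).smallCouplings → (leavesP w P).smallFieldInductive)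
    (h10 : ∀ P : B12.RunParams, B9LeafX (Y9OfRecord N (theta13LiveOfNumerics F N n ε₂₉ ζ Rz Zt).toStage3Params Mstar ops) →
      (B10.Thm1PrintedCompact ((((theta13LiveOfNumerics F N n ε₂₉ ζ Rz Zt).rebindX F N X').view₁₃B10YZW F N Mstar ops ζ9 lamW).res.X P).runs10 ∧
          B10.Thm2Printed ((((theta13LiveOfNumerics F N n ε₂₉ ζ Rz Zt).rebindX F N X').view₁₃B10YZW F N Mstar ops ζ9 lamW).res.X P).runs10) →
        B11Leaf (Z11OfRecord F N ζ9) → B12Sec2to5.Lemma4Printed (X' P).F12 (X' P).c12 →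
          B13.Lemma1Printed (X' P).S13 (X' P).c13 ∧ B13.Lemma2Printed (X' P).S13 (X' P).c13 ∧
            B13.Lemma3Printed (X' P).S13 (X' P).c13)
    (h11 : ∀ P : B12.RunParams, (leavesP w P).b7 → (leavesP w P).b8 → (leavesP w P).b9 → (leavesP w P).b10 → (leavesP w P).b11 →
      (leavesP w P).smallCouplings → (leavesP w P).smallFieldInductive → (leavesP w P).flowControl →
        ∀ k, k < P.K → SLaw₁₃ F N (theta13LiveOfNumerics F N n ε₂₉ ζ Rz Zt) P k → TLaw₁₃ F N (theta13LiveOfNumerics F N n ε₂₉ ζ Rz Zt) P k)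
    (h12 : ∀ P : B12.RunParams, B15Leaf (WOfRecord₁₃ F N (theta13LiveOfNumerics F N n ε₂₉ ζ Rz Zt) lamW P))
    (hUV : ∀ P : B12.RunParams, (genFlow (betaOfRecord₁₃ F N (theta13LiveOfNumerics F N n ε₂₉ ζ Rz Zt)) P.g0).InInterval w.γ P.K → ∀ k, k ≤ P.K → SLaw₁₃ F N (theta13LiveOfNumerics F N n ε₂₉ ζ Rz Zt) P k →
      ∀ U : GaugeField (F.P P.K) k (SU N),
        chiβOfRecord₁₃ F N (theta13LiveOfNumerics F N n ε₂₉ ζ Rz Zt) P.K (gOfRecord₁₃ F N (theta13LiveOfNumerics F N n ε₂₉ ζ Rz Zt) P) k U *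
              Real.exp (-(1 / (gOfRecord₁₃ F N (theta13LiveOfNumerics F N n ε₂₉ ζ Rz Zt) P k) ^ 2 * wilsonBGOfRecord F N (theta13LiveOfNumerics F N n ε₂₉ ζ Rz Zt).εbg P k U)
                - w.em (gOfRecord₁₃ F N (theta13LiveOfNumerics F N n ε₂₉ ζ Rz Zt) P k) * (Fintype.card (Site (F.P P.K) k) : ℝ)) ≤ densOfRecord₁₃ F N (theta13LiveOfNumerics F N n ε₂₉ ζ Rz Zt) P k U ∧
        densOfRecord₁₃ F N (theta13LiveOfNumerics F N n ε₂₉ ζ Rz Zt) P k U ≤ Real.exp (w.ep (gOfRecord₁₃ F N (theta13LiveOfNumerics F N n ε₂₉ ζ Rz Zt) P k) * (Fintype.card (Site (F.P P.K) k) : ℝ)))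
    (hlo : BetaLowerH w.b w.γ (datumOfRecord₁₃Sep F N (theta13LiveOfNumerics F N n ε₂₉ ζ Rz Zt) hP).βfun) (hhi : BetaUpperH w.βup w.γ (datumOfRecord₁₃Sep F N (theta13LiveOfNumerics F N n ε₂₉ ζ Rz Zt) hP).βfun) :
    ∃ (θ' : Stage13Params F N) (h' : θ'.Provisos₁₃Sep F N), (θ'.ZtUnity F N ∧ θ'.SlotsNondegenerate₁₃ F N) ∧ θ'.Admissible F N ∧
      B16.EndStatementBPrinted (datumOfRecord₁₃Sep F N θ' h').C ∧
      ∃ γ₁ : ℝ, 0 < γ₁ ∧ ∀ γ : ℝ, 0 < γ → γ ≤ γ₁ → ∃ P : B12.RunParams, 1 ≤ P.K ∧ ((datumOfRecord₁₃Sep F N θ' h').C P).flow.InInterval γ P.K :=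
  N24_stabilityBR13Sep_thetaShape18_rebindX_fourPin_pointed (theta13LiveOfNumerics F N n ε₂₉ ζ Rz Zt) hP (admissible_theta13LiveOfNumerics F N ζ Rz Zt hn hε')
    ⟨hZ, (Stage13Params.slotsNondegenerate₁₃_liveRepin_of_int F N (theta13OfNumerics F N n ε₂₉ ζ Rz Zt) (fun p j hj => hP.tstep p j hj) (fun p j _ hj => hP.rstep p j hj))⟩ X' Mstar ops ζ9 lamW w hC hγ hL hup h05 h06 h07 h08 h09 h09T h10 h11 h12
    (fun P k hk => laws₁₃_liveRepin₁₃_sep F N (theta13OfNumerics F N n ε₂₉ ζ Rz Zt) P hP (admissible_theta13OfNumerics F N ζ Rz Zt hn hε') hκ hE₀ hB₀ k hk) hUV hlo hhi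

/-- **THE ∃-BODY OF `BetaWindowAtSomeRecord13` WITNESSED BY `(theta13LiveOfNumerics F N n ε₂₉ ζ Rz Zt, hP, w)`**, children over the X-rebound four-pin view (same slots).
[cite: Balaban1989LargeFieldII, Thm 1 p.355, (0.1) pp.355–356, p.391; Balaban1988Convergent, p.244, Thm 2 p.263; Balaban1987RG1, Thm 3 p.264, (0.17)–(0.21) pp.255–256 and (1.22) p.264; Balaban1985UV3, Thm 1 p.257 (bookkeeping + elementary window)] -/
theorem N24_betaWindowAtSomeRecord₁₃Sep_of_rebindX_fourPin_pointed_theta13LiveOfNumerics_of_boxH {n : Stage12Numerics} {ε₂₉ : ℝ} (hn : n.Pos) (hε' : 0 < ε₂₉)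
    (hκ : 0 ≤ n.s2.lf.κ) (hE₀ : 0 ≤ n.s2.lf.E₀) (hB₀ : 0 ≤ n.s2.lf.B₀) (ζ : ZetaOfRecord F N n.ν n.τ9.M) (Rz : (K : ℕ) → Sect2.Residual (F.P K) (MatA N))
    (Zt : (K : ℕ) → TkResidualW F N (FluctV N) K) (hP : (theta13LiveOfNumerics F N n ε₂₉ ζ Rz Zt).Provisos₁₃Sep F N)
    (hZ : (theta13LiveOfNumerics F N n ε₂₉ ζ Rz Zt).ZtUnity F N) (X' : B12.RunParams → PrintedCarriersR)
    (Mstar : ℕ) (ops : OpsY N (theta13LiveOfNumerics F N n ε₂₉ ζ Rz Zt).toStage3Params Mstar) (ζ9 : ResidZ F N) (lamW : ResidW F N) (w : WorldP)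
    (hC : w.C = (datumOfRecord₁₃Sep F N (theta13LiveOfNumerics F N n ε₂₉ ζ Rz Zt) hP).C) (hγ : 0 < w.γ ∧ w.γ ≤ (theta13LiveOfNumerics F N n ε₂₉ ζ Rz Zt).γ) (hL : w.L = ((theta13LiveOfNumerics F N n ε₂₉ ζ Rz Zt).L : ℝ))
    (hup : ∀ P, w.up P = upOfRecord₅C F N (((theta13LiveOfNumerics F N n ε₂₉ ζ Rz Zt).rebindX F N X').view₁₃B10YZW F N Mstar ops ζ9 lamW) P)
    (h05 : ∀ P : B12.RunParams,
      B8LeafR (X' P).d8 (X' P).L8 (X' P).C₂ (X' P).B₁' (X' P).B₀' (X' P).B₁ (X' P).B₂ (X' P).c₁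
        (X' P).inp8 (X' P).B₀β (X' P).loc8 (X' P).fam8R (X' P).lan8 (X' P).cub8 (X' P).toAxial8)
    (h06 : B9LeafX (Y9OfRecord N (theta13LiveOfNumerics F N n ε₂₉ ζ Rz Zt).toStage3Params Mstar ops))
    (h07 : B11Leaf (Z11OfRecord F N ζ9))
    (h08 : PrintedUV3V N (theta13LiveOfNumerics F N n ε₂₉ ζ Rz Zt).L)
    (h09 : ∀ P : B12.RunParams, B12Sec2to5.Lemma4Printed (X' P).F12 (X' P).c12)
    (h09T : ∀ P : B12.RunParams, (leavesP w P).smallCouplings → (leavesP w P).smallFieldInductive)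
    (h10 : ∀ P : B12.RunParams, B9LeafX (Y9OfRecord N (theta13LiveOfNumerics F N n ε₂₉ ζ Rz Zt).toStage3Params Mstar ops) →
      (B10.Thm1PrintedCompact ((((theta13LiveOfNumerics F N n ε₂₉ ζ Rz Zt).rebindX F N X').view₁₃B10YZW F N Mstar ops ζ9 lamW).res.X P).runs10 ∧
          B10.Thm2Printed ((((theta13LiveOfNumerics F N n ε₂₉ ζ Rz Zt).rebindX F N X').view₁₃B10YZW F N Mstar ops ζ9 lamW).res.X P).runs10) →
        B11Leaf (Z11OfRecord F N ζ9) → B12Sec2to5.Lemma4Printed (X' P).F12 (X' P).c12 →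
          B13.Lemma1Printed (X' P).S13 (X' P).c13 ∧ B13.Lemma2Printed (X' P).S13 (X' P).c13 ∧
            B13.Lemma3Printed (X' P).S13 (X' P).c13)
    (h11 : ∀ P : B12.RunParams, (leavesP w P).b7 → (leavesP w P).b8 → (leavesP w P).b9 → (leavesP w P).b10 → (leavesP w P).b11 →
      (leavesP w P).smallCouplings → (leavesP w P).smallFieldInductive → (leavesP w P).flowControl →
        ∀ k, k < P.K → SLaw₁₃ F N (theta13LiveOfNumerics F N n ε₂₉ ζ Rz Zt) P k → TLaw₁₃ F N (theta13LiveOfNumerics F N n ε₂₉ ζ Rz Zt) P k)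
    (h12 : ∀ P : B12.RunParams, B15Leaf (WOfRecord₁₃ F N (theta13LiveOfNumerics F N n ε₂₉ ζ Rz Zt) lamW P))
    (hUV : ∀ P : B12.RunParams, (genFlow (betaOfRecord₁₃ F N (theta13LiveOfNumerics F N n ε₂₉ ζ Rz Zt)) P.g0).InInterval w.γ P.K → ∀ k, k ≤ P.K → SLaw₁₃ F N (theta13LiveOfNumerics F N n ε₂₉ ζ Rz Zt) P k →
      ∀ U : GaugeField (F.P P.K) k (SU N),
        chiβOfRecord₁₃ F N (theta13LiveOfNumerics F N n ε₂₉ ζ Rz Zt) P.K (gOfRecord₁₃ F N (theta13LiveOfNumerics F N n ε₂₉ ζ Rz Zt) P) k U *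
              Real.exp (-(1 / (gOfRecord₁₃ F N (theta13LiveOfNumerics F N n ε₂₉ ζ Rz Zt) P k) ^ 2 * wilsonBGOfRecord F N (theta13LiveOfNumerics F N n ε₂₉ ζ Rz Zt).εbg P k U)
                - w.em (gOfRecord₁₃ F N (theta13LiveOfNumerics F N n ε₂₉ ζ Rz Zt) P k) * (Fintype.card (Site (F.P P.K) k) : ℝ)) ≤ densOfRecord₁₃ F N (theta13LiveOfNumerics F N n ε₂₉ ζ Rz Zt) P k U ∧
        densOfRecord₁₃ F N (theta13LiveOfNumerics F N n ε₂₉ ζ Rz Zt) P k U ≤ Real.exp (w.ep (gOfRecord₁₃ F N (theta13LiveOfNumerics F N n ε₂₉ ζ Rz Zt) P k) * (Fintype.card (Site (F.P P.K) k) : ℝ)))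
    (hlo : BetaLowerH w.b w.γ (datumOfRecord₁₃Sep F N (theta13LiveOfNumerics F N n ε₂₉ ζ Rz Zt) hP).βfun) (hhi : BetaUpperH w.βup w.γ (datumOfRecord₁₃Sep F N (theta13LiveOfNumerics F N n ε₂₉ ζ Rz Zt) hP).βfun) :
    ∃ (θ' : Stage13Params F N) (h' : θ'.Provisos₁₃Sep F N) (w' : WorldP), (θ'.ZtUnity F N ∧ θ'.SlotsNondegenerate₁₃ F N) ∧ θ'.Admissible F N ∧
      IsRecordOfRecord₁₃CSep F N (datumOfRecord₁₃Sep F N θ' h') w' ∧ (∀ P : B12.RunParams, Nodes (leavesP w' P)) ∧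
      BetaBoundsInInterval w'.C.toB12 w'.γ w'.b w'.βup ∧
      ∃ γ₁ : ℝ, 0 < γ₁ ∧ ∀ γ : ℝ, 0 < γ → γ ≤ γ₁ → ∃ P : B12.RunParams, 1 ≤ P.K ∧ ((datumOfRecord₁₃Sep F N θ' h').C P).flow.InInterval γ P.K :=
  N24_betaWindowAtSomeRecord₁₃Sep_of_rebindX_fourPin_pointed_of_boxH (theta13LiveOfNumerics F N n ε₂₉ ζ Rz Zt) hP (admissible_theta13LiveOfNumerics F N ζ Rz Zt hn hε')
    ⟨hZ, (Stage13Params.slotsNondegenerate₁₃_liveRepin_of_int F N (theta13OfNumerics F N n ε₂₉ ζ Rz Zt) (fun p j hj => hP.tstep p j hj) (fun p j _ hj => hP.rstep p j hj))⟩ X' Mstar ops ζ9 lamW w hC hγ hL hup h05 h06 h07 h08 h09 h09T h10 h11 h12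
    (fun P k hk => laws₁₃_liveRepin₁₃_sep F N (theta13OfNumerics F N n ε₂₉ ζ Rz Zt) P hP (admissible_theta13OfNumerics F N ζ Rz Zt hn hε') hκ hE₀ hB₀ k hk) hUV hlo hhi

/-! ## §2. At the open-letter member `theta13LiveOfFamily₂ F N ε₀ ε₂₉ ζ Rz Zt` -/

/-- **★ ITEM K1⁗'s θ-KEYED CONSEQUENT WITNESSED BY `(theta13LiveOfFamily₂ F N ε₀ ε₂₉ ζ Rz Zt, hP)`, CHILDREN OVER THE X-REBOUND FOUR-PIN VIEW** — `Admissible`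
(`admissible_theta13LiveOfFamily₂ hε hε'`), `SlotsNondegenerate₁₃` (K0a's `slotsNondegenerate₁₃_liveRepin_of_int` from `hP.tstep ∕ hP.rstep`), N13's (R₁₃) (dag-n11-e's `laws₁₃_liveRepin₁₃_sep` at `theta13OfFamily₂`, `admissible_theta13OfFamily₂ hε hε'`, n11-e's sign lemmas) by name; `hZ` displayed.
[cite: Balaban1989LargeFieldII, Thm 1 p.355, (0.1) pp.355–356, p.391; Balaban1988Convergent, p.244, Thm 2 p.263, (3.16)–(3.22) pp.268–269; Balaban1989LargeFieldI, (0.2)–(0.4) p.176; Balaban1987RG1, (0.1) p.251, (2.9) p.266, Thm 3 p.264, (1.22) p.264; Balaban1985UV3, Thm 1 p.257 (bookkeeping + elementary window)] -/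
theorem N24_stabilityBR13Sep_thetaShape18_rebindX_fourPin_pointed_theta13LiveOfFamily₂ {ε₀ ε₂₉ : ℝ} (hε : 0 < ε₀) (hε' : 0 < ε₂₉) (ζ : ZetaOfRecord F N (numerics7OfFamily ε₀) 1)
    (Rz : (K : ℕ) → Sect2.Residual (F.P K) (MatA N)) (Zt : (K : ℕ) → TkResidualW F N (FluctV N) K)
    (hP : (theta13LiveOfFamily₂ F N ε₀ ε₂₉ ζ Rz Zt).Provisos₁₃Sep F N) (hZ : (theta13LiveOfFamily₂ F N ε₀ ε₂₉ ζ Rz Zt).ZtUnity F N) (X' : B12.RunParams → PrintedCarriersR)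
    (Mstar : ℕ) (ops : OpsY N (theta13LiveOfFamily₂ F N ε₀ ε₂₉ ζ Rz Zt).toStage3Params Mstar) (ζ9 : ResidZ F N) (lamW : ResidW F N) (w : WorldP)
    (hC : w.C = (datumOfRecord₁₃Sep F N (theta13LiveOfFamily₂ F N ε₀ ε₂₉ ζ Rz Zt) hP).C) (hγ : 0 < w.γ ∧ w.γ ≤ (theta13LiveOfFamily₂ F N ε₀ ε₂₉ ζ Rz Zt).γ) (hL : w.L = ((theta13LiveOfFamily₂ F N ε₀ ε₂₉ ζ Rz Zt).L : ℝ))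
    (hup : ∀ P, w.up P = upOfRecord₅C F N (((theta13LiveOfFamily₂ F N ε₀ ε₂₉ ζ Rz Zt).rebindX F N X').view₁₃B10YZW F N Mstar ops ζ9 lamW) P)
    (h05 : ∀ P : B12.RunParams,
      B8LeafR (X' P).d8 (X' P).L8 (X' P).C₂ (X' P).B₁' (X' P).B₀' (X' P).B₁ (X' P).B₂ (X' P).c₁
        (X' P).inp8 (X' P).B₀β (X' P).loc8 (X' P).fam8R (X' P).lan8 (X' P).cub8 (X' P).toAxial8)
    (h06 : B9LeafX (Y9OfRecord N (theta13LiveOfFamily₂ F N ε₀ ε₂₉ ζ Rz Zt).toStage3Params Mstar ops))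
    (h07 : B11Leaf (Z11OfRecord F N ζ9))
    (h08 : PrintedUV3V N (theta13LiveOfFamily₂ F N ε₀ ε₂₉ ζ Rz Zt).L)
    (h09 : ∀ P : B12.RunParams, B12Sec2to5.Lemma4Printed (X' P).F12 (X' P).c12)
    (h09T : ∀ P : B12.RunParams, (leavesP w P).smallCouplings → (leavesP w P).smallFieldInductive)
    (h10 : ∀ P : B12.RunParams, B9LeafX (Y9OfRecord N (theta13LiveOfFamily₂ F N ε₀ ε₂₉ ζ Rz Zt).toStage3Params Mstar ops) →
      (B10.Thm1PrintedCompact ((((theta13LiveOfFamily₂ F N ε₀ ε₂₉ ζ Rz Zt).rebindX F N X').view₁₃B10YZW F N Mstar ops ζ9 lamW).res.X P).runs10 ∧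
          B10.Thm2Printed ((((theta13LiveOfFamily₂ F N ε₀ ε₂₉ ζ Rz Zt).rebindX F N X').view₁₃B10YZW F N Mstar ops ζ9 lamW).res.X P).runs10) →
        B11Leaf (Z11OfRecord F N ζ9) → B12Sec2to5.Lemma4Printed (X' P).F12 (X' P).c12 →
          B13.Lemma1Printed (X' P).S13 (X' P).c13 ∧ B13.Lemma2Printed (X' P).S13 (X' P).c13 ∧
            B13.Lemma3Printed (X' P).S13 (X' P).c13)
    (h11 : ∀ P : B12.RunParams, (leavesP w P).b7 → (leavesP w P).b8 → (leavesP w P).b9 → (leavesP w P).b10 → (leavesP w P).b11 →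
      (leavesP w P).smallCouplings → (leavesP w P).smallFieldInductive → (leavesP w P).flowControl →
        ∀ k, k < P.K → SLaw₁₃ F N (theta13LiveOfFamily₂ F N ε₀ ε₂₉ ζ Rz Zt) P k → TLaw₁₃ F N (theta13LiveOfFamily₂ F N ε₀ ε₂₉ ζ Rz Zt) P k)
    (h12 : ∀ P : B12.RunParams, B15Leaf (WOfRecord₁₃ F N (theta13LiveOfFamily₂ F N ε₀ ε₂₉ ζ Rz Zt) lamW P))
    (hUV : ∀ P : B12.RunParams, (genFlow (betaOfRecord₁₃ F N (theta13LiveOfFamily₂ F N ε₀ ε₂₉ ζ Rz Zt)) P.g0).InInterval w.γ P.K → ∀ k, k ≤ P.K → SLaw₁₃ F N (theta13LiveOfFamily₂ F N ε₀ ε₂₉ ζ Rz Zt) P k →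
      ∀ U : GaugeField (F.P P.K) k (SU N),
        chiβOfRecord₁₃ F N (theta13LiveOfFamily₂ F N ε₀ ε₂₉ ζ Rz Zt) P.K (gOfRecord₁₃ F N (theta13LiveOfFamily₂ F N ε₀ ε₂₉ ζ Rz Zt) P) k U *
              Real.exp (-(1 / (gOfRecord₁₃ F N (theta13LiveOfFamily₂ F N ε₀ ε₂₉ ζ Rz Zt) P k) ^ 2 * wilsonBGOfRecord F N (theta13LiveOfFamily₂ F N ε₀ ε₂₉ ζ Rz Zt).εbg P k U)
                - w.em (gOfRecord₁₃ F N (theta13LiveOfFamily₂ F N ε₀ ε₂₉ ζ Rz Zt) P k) * (Fintype.card (Site (F.P P.K) k) : ℝ)) ≤ densOfRecord₁₃ F N (theta13LiveOfFamily₂ F N ε₀ ε₂₉ ζ Rz Zt) P k U ∧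
        densOfRecord₁₃ F N (theta13LiveOfFamily₂ F N ε₀ ε₂₉ ζ Rz Zt) P k U ≤ Real.exp (w.ep (gOfRecord₁₃ F N (theta13LiveOfFamily₂ F N ε₀ ε₂₉ ζ Rz Zt) P k) * (Fintype.card (Site (F.P P.K) k) : ℝ)))
    (hlo : BetaLowerH w.b w.γ (datumOfRecord₁₃Sep F N (theta13LiveOfFamily₂ F N ε₀ ε₂₉ ζ Rz Zt) hP).βfun) (hhi : BetaUpperH w.βup w.γ (datumOfRecord₁₃Sep F N (theta13LiveOfFamily₂ F N ε₀ ε₂₉ ζ Rz Zt) hP).βfun) :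
    ∃ (θ' : Stage13Params F N) (h' : θ'.Provisos₁₃Sep F N), (θ'.ZtUnity F N ∧ θ'.SlotsNondegenerate₁₃ F N) ∧ θ'.Admissible F N ∧
      B16.EndStatementBPrinted (datumOfRecord₁₃Sep F N θ' h').C ∧
      ∃ γ₁ : ℝ, 0 < γ₁ ∧ ∀ γ : ℝ, 0 < γ → γ ≤ γ₁ → ∃ P : B12.RunParams, 1 ≤ P.K ∧ ((datumOfRecord₁₃Sep F N θ' h').C P).flow.InInterval γ P.K :=
  N24_stabilityBR13Sep_thetaShape18_rebindX_fourPin_pointed (theta13LiveOfFamily₂ F N ε₀ ε₂₉ ζ Rz Zt) hP (admissible_theta13LiveOfFamily₂ F N ζ Rz Zt hε hε')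
    ⟨hZ, (Stage13Params.slotsNondegenerate₁₃_liveRepin_of_int F N (theta13OfFamily₂ F N ε₀ ε₂₉ ζ Rz Zt) (fun p j hj => hP.tstep p j hj) (fun p j _ hj => hP.rstep p j hj))⟩ X' Mstar ops ζ9 lamW w hC hγ hL hup h05 h06 h07 h08 h09 h09T h10 h11 h12
    (fun P k hk => laws₁₃_liveRepin₁₃_sep F N (theta13OfFamily₂ F N ε₀ ε₂₉ ζ Rz Zt) P hP (admissible_theta13OfFamily₂ F N ζ Rz Zt hε hε') (kappa_nonneg_theta13LiveOfFamily₂ F N ε₀ ε₂₉ ζ Rz Zt) (E0_nonneg_theta13LiveOfFamily₂ F N ε₀ ε₂₉ ζ Rz Zt) (B0_nonneg_theta13LiveOfFamily₂ F N ε₀ ε₂₉ ζ Rz Zt) k hk) hUV hlo hhi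

/-- **THE ∃-BODY OF `BetaWindowAtSomeRecord13` WITNESSED BY `(theta13LiveOfFamily₂ F N ε₀ ε₂₉ ζ Rz Zt, hP, w)`**, children over the X-rebound four-pin view (same slots).
[cite: Balaban1989LargeFieldII, Thm 1 p.355, (0.1) pp.355–356, p.391; Balaban1988Convergent, p.244, Thm 2 p.263; Balaban1987RG1, Thm 3 p.264, (0.17)–(0.21) pp.255–256 and (1.22) p.264; Balaban1985UV3, Thm 1 p.257 (bookkeeping + elementary window)] -/
theorem N24_betaWindowAtSomeRecord₁₃Sep_of_rebindX_fourPin_pointed_theta13LiveOfFamily₂_of_boxH {ε₀ ε₂₉ : ℝ} (hε : 0 < ε₀) (hε' : 0 < ε₂₉) (ζ : ZetaOfRecord F N (numerics7OfFamily ε₀) 1)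
    (Rz : (K : ℕ) → Sect2.Residual (F.P K) (MatA N)) (Zt : (K : ℕ) → TkResidualW F N (FluctV N) K)
    (hP : (theta13LiveOfFamily₂ F N ε₀ ε₂₉ ζ Rz Zt).Provisos₁₃Sep F N) (hZ : (theta13LiveOfFamily₂ F N ε₀ ε₂₉ ζ Rz Zt).ZtUnity F N) (X' : B12.RunParams → PrintedCarriersR)
    (Mstar : ℕ) (ops : OpsY N (theta13LiveOfFamily₂ F N ε₀ ε₂₉ ζ Rz Zt).toStage3Params Mstar) (ζ9 : ResidZ F N) (lamW : ResidW F N) (w : WorldP)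
    (hC : w.C = (datumOfRecord₁₃Sep F N (theta13LiveOfFamily₂ F N ε₀ ε₂₉ ζ Rz Zt) hP).C) (hγ : 0 < w.γ ∧ w.γ ≤ (theta13LiveOfFamily₂ F N ε₀ ε₂₉ ζ Rz Zt).γ) (hL : w.L = ((theta13LiveOfFamily₂ F N ε₀ ε₂₉ ζ Rz Zt).L : ℝ))
    (hup : ∀ P, w.up P = upOfRecord₅C F N (((theta13LiveOfFamily₂ F N ε₀ ε₂₉ ζ Rz Zt).rebindX F N X').view₁₃B10YZW F N Mstar ops ζ9 lamW) P)
    (h05 : ∀ P : B12.RunParams,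
      B8LeafR (X' P).d8 (X' P).L8 (X' P).C₂ (X' P).B₁' (X' P).B₀' (X' P).B₁ (X' P).B₂ (X' P).c₁
        (X' P).inp8 (X' P).B₀β (X' P).loc8 (X' P).fam8R (X' P).lan8 (X' P).cub8 (X' P).toAxial8)
    (h06 : B9LeafX (Y9OfRecord N (theta13LiveOfFamily₂ F N ε₀ ε₂₉ ζ Rz Zt).toStage3Params Mstar ops))
    (h07 : B11Leaf (Z11OfRecord F N ζ9))
    (h08 : PrintedUV3V N (theta13LiveOfFamily₂ F N ε₀ ε₂₉ ζ Rz Zt).L)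
    (h09 : ∀ P : B12.RunParams, B12Sec2to5.Lemma4Printed (X' P).F12 (X' P).c12)
    (h09T : ∀ P : B12.RunParams, (leavesP w P).smallCouplings → (leavesP w P).smallFieldInductive)
    (h10 : ∀ P : B12.RunParams, B9LeafX (Y9OfRecord N (theta13LiveOfFamily₂ F N ε₀ ε₂₉ ζ Rz Zt).toStage3Params Mstar ops) →
      (B10.Thm1PrintedCompact ((((theta13LiveOfFamily₂ F N ε₀ ε₂₉ ζ Rz Zt).rebindX F N X').view₁₃B10YZW F N Mstar ops ζ9 lamW).res.X P).runs10 ∧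
          B10.Thm2Printed ((((theta13LiveOfFamily₂ F N ε₀ ε₂₉ ζ Rz Zt).rebindX F N X').view₁₃B10YZW F N Mstar ops ζ9 lamW).res.X P).runs10) →
        B11Leaf (Z11OfRecord F N ζ9) → B12Sec2to5.Lemma4Printed (X' P).F12 (X' P).c12 →
          B13.Lemma1Printed (X' P).S13 (X' P).c13 ∧ B13.Lemma2Printed (X' P).S13 (X' P).c13 ∧
            B13.Lemma3Printed (X' P).S13 (X' P).c13)
    (h11 : ∀ P : B12.RunParams, (leavesP w P).b7 → (leavesP w P).b8 → (leavesP w P).b9 → (leavesP w P).b10 → (leavesP w P).b11 →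
      (leavesP w P).smallCouplings → (leavesP w P).smallFieldInductive → (leavesP w P).flowControl →
        ∀ k, k < P.K → SLaw₁₃ F N (theta13LiveOfFamily₂ F N ε₀ ε₂₉ ζ Rz Zt) P k → TLaw₁₃ F N (theta13LiveOfFamily₂ F N ε₀ ε₂₉ ζ Rz Zt) P k)
    (h12 : ∀ P : B12.RunParams, B15Leaf (WOfRecord₁₃ F N (theta13LiveOfFamily₂ F N ε₀ ε₂₉ ζ Rz Zt) lamW P))
    (hUV : ∀ P : B12.RunParams, (genFlow (betaOfRecord₁₃ F N (theta13LiveOfFamily₂ F N ε₀ ε₂₉ ζ Rz Zt)) P.g0).InInterval w.γ P.K → ∀ k, k ≤ P.K → SLaw₁₃ F N (theta13LiveOfFamily₂ F N ε₀ ε₂₉ ζ Rz Zt) P k →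
      ∀ U : GaugeField (F.P P.K) k (SU N),
        chiβOfRecord₁₃ F N (theta13LiveOfFamily₂ F N ε₀ ε₂₉ ζ Rz Zt) P.K (gOfRecord₁₃ F N (theta13LiveOfFamily₂ F N ε₀ ε₂₉ ζ Rz Zt) P) k U *
              Real.exp (-(1 / (gOfRecord₁₃ F N (theta13LiveOfFamily₂ F N ε₀ ε₂₉ ζ Rz Zt) P k) ^ 2 * wilsonBGOfRecord F N (theta13LiveOfFamily₂ F N ε₀ ε₂₉ ζ Rz Zt).εbg P k U)
                - w.em (gOfRecord₁₃ F N (theta13LiveOfFamily₂ F N ε₀ ε₂₉ ζ Rz Zt) P k) * (Fintype.card (Site (F.P P.K) k) : ℝ)) ≤ densOfRecord₁₃ F N (theta13LiveOfFamily₂ F N ε₀ ε₂₉ ζ Rz Zt) P k U ∧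
        densOfRecord₁₃ F N (theta13LiveOfFamily₂ F N ε₀ ε₂₉ ζ Rz Zt) P k U ≤ Real.exp (w.ep (gOfRecord₁₃ F N (theta13LiveOfFamily₂ F N ε₀ ε₂₉ ζ Rz Zt) P k) * (Fintype.card (Site (F.P P.K) k) : ℝ)))
    (hlo : BetaLowerH w.b w.γ (datumOfRecord₁₃Sep F N (theta13LiveOfFamily₂ F N ε₀ ε₂₉ ζ Rz Zt) hP).βfun) (hhi : BetaUpperH w.βup w.γ (datumOfRecord₁₃Sep F N (theta13LiveOfFamily₂ F N ε₀ ε₂₉ ζ Rz Zt) hP).βfun) :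
    ∃ (θ' : Stage13Params F N) (h' : θ'.Provisos₁₃Sep F N) (w' : WorldP), (θ'.ZtUnity F N ∧ θ'.SlotsNondegenerate₁₃ F N) ∧ θ'.Admissible F N ∧
      IsRecordOfRecord₁₃CSep F N (datumOfRecord₁₃Sep F N θ' h') w' ∧ (∀ P : B12.RunParams, Nodes (leavesP w' P)) ∧
      BetaBoundsInInterval w'.C.toB12 w'.γ w'.b w'.βup ∧
      ∃ γ₁ : ℝ, 0 < γ₁ ∧ ∀ γ : ℝ, 0 < γ → γ ≤ γ₁ → ∃ P : B12.RunParams, 1 ≤ P.K ∧ ((datumOfRecord₁₃Sep F N θ' h').C P).flow.InInterval γ P.K :=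
  N24_betaWindowAtSomeRecord₁₃Sep_of_rebindX_fourPin_pointed_of_boxH (theta13LiveOfFamily₂ F N ε₀ ε₂₉ ζ Rz Zt) hP (admissible_theta13LiveOfFamily₂ F N ζ Rz Zt hε hε')
    ⟨hZ, (Stage13Params.slotsNondegenerate₁₃_liveRepin_of_int F N (theta13OfFamily₂ F N ε₀ ε₂₉ ζ Rz Zt) (fun p j hj => hP.tstep p j hj) (fun p j _ hj => hP.rstep p j hj))⟩ X' Mstar ops ζ9 lamW w hC hγ hL hup h05 h06 h07 h08 h09 h09T h10 h11 h12
    (fun P k hk => laws₁₃_liveRepin₁₃_sep F N (theta13OfFamily₂ F N ε₀ ε₂₉ ζ Rz Zt) P hP (admissible_theta13OfFamily₂ F N ζ Rz Zt hε hε') (kappa_nonneg_theta13LiveOfFamily₂ F N ε₀ ε₂₉ ζ Rz Zt) (E0_nonneg_theta13LiveOfFamily₂ F N ε₀ ε₂₉ ζ Rz Zt) (B0_nonneg_theta13LiveOfFamily₂ F N ε₀ ε₂₉ ζ Rz Zt) k hk) hUV hlo hhi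

end Literature.MathematicalPhysics.QuantumFieldTheory.Balaban1983to89.Node00

end
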